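import Summits.PneNP.PneNP.Theorems.ChebyshevTracialDesignGammaDirectionTools
import HarnessLib

/-!
# Cell pnp-psdrank, route `ChebyshevTracialDesign`: the `n_A`-part of the γ-direction's main profile — design value = minus virtual value
# up to a pure remainder (crux `TracialDecayExp20`, stmt-PneNP-19878)

Brick 129c (prover g26; MEMO-28 §3c line (L-b), MEMO-29). The main profile of the γ-direction (brick 129) is
`Φ(c) = E_{Shell_c(M)}[ψ(X)·(2γ n_A + 2λX + κt)²] = φ₀(c) + Φ₁(c)` with `φ₀` brick 120's crossing-plane profile and
`Φ₁(c) = E_{Shell_c(M)}[α·ψ(X)·n_A(n_A−1) + χ(X)·n_A]` (`α = 4γ²`, `χ = 4γ²ψ + 4γψ·(2λx+κt)`). By full-edge pinning (brick 129a §3) the odd-level values of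
`Φ₁` are `α(t−c)(t−2−c)·θ₂(c) + (t−c)·θ₁(c)` with `θ₁, θ₂` block-statistic profiles on ground sets with one / two `HH` edges deleted (the GENUINE level-`c`
pinning probabilities `s_c/N`, `s_c(s_c−1)/(N(N−1))` are kept — so that `Φ` and its `x`-sections stay expectations of nonnegative quantities at every genuine
level, which is what brick 121's criterion needs in the centred basis of MEMO-28 §3c); its `(D+1)`-st level difference is bounded by the affine Leibniz rule
(129a §1, applied twice for the quadratic prefactor) and the deleted-profile smoothness (129a §2), and the exact design's remainder estimate gives
**`abs_levelSum_hhMoments_add_newton_le`**: `|Σ_c w_c Φ₁(c) + N^{odd}_D[Φ₁](0)| ≤ B_v·C((T−1)/2,D+1)·K₇`,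
`K₇ = G₂(tρ^{D+1}X_{D+1} + 2(D+1)ρ^DX_D) + |α|·G·(t(tρ^{D+1}X_{D+1} + 2(D+1)ρ^DX_D) + 2(D+1)(tρ^DX_D + 2Dρ^{D−1}X_{D−1}))` — a PURE REMAINDER of orders
`D−1, D, D+1` (two hypothesis families: ground sets `[n]` minus one / two pinned edges and `2k` deleted edges, cuts `t−2−2k` / `t−4−2k`; prefactors
`|reps vAA|/n ≤ 1`, `|reps vAA|²/(n(n−2)) ≤ 1` from `2|reps vAA| ≤ n`). Levels up to `T` at cut `t−4` need `T + 4 ≤ t`.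
WHAT THIS FILE DOES NOT DO: the assembly with brick 120 (brick 129), bound the `X_k`, sign `N^{odd}_D[Φ](0)` ((O3)), anything on `TracialDecayExp20`
itself, psd rank of P_PM(K_n), or P vs NP.
[cite: Rothvoss2017, §2 (PDF p. 6)] [cite: Agarwal2000DifferenceEquations, Thm. 1.8.5 (1.8.6), Remark 1.8.1 (1.8.8)]
[cite: Boole2009, Ch. II Art. 10 Ex. 3 eq. (8) (PDF pp. 34–35)] [cite: GriblingDelaatLaurent2019, §5]
Stature: support/instrument (kernel lane, no defs, axioms standard). Supports stmt-PneNP-19878.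
-/

set_option linter.dupNamespace false -- `Summit.PneNP.PneNP.…`: summit = sub-problem (D-0017)

noncomputable section

namespace Summit.PneNP.PneNP.Theorems.ChebyshevTracialDesignGammaDirectionMainTerm

open Finset Polynomial Literature.Barriers.PneNP Literature.Combinatorics.Optimization
open Literature.Combinatorics.Optimization.ShellStep
open Summit.PneNP.PneNP.Theorems.ChebyshevTracialDesignShellOperatorForm (shell_partner_nonempty)
open Summit.PneNP.PneNP.Theorems.ChebyshevTracialDesignBlockStatisticPricing (fwdDiff_iter_one_odd pairs_hyp rho_nonneg)
open Summit.PneNP.PneNP.Theorems.ChebyshevTracialDesignHalfPinnedNull (fwdDiff_iter_mul_sum)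
open Summit.PneNP.PneNP.Theorems.ChebyshevTracialDesignGammaDirectionTools

variable {n : ℕ}
/-! ### (T7) The `n_A`-part of the main profile: its design value is its virtual value up to a pure remainder -/

/-- **(T7) The `n_A`-moments profile `Φ₁(c) = E_{Shell_c(M)}[α·ψ(X)·n_A(n_A−1) + χ(X)·n_A]`: design value = minus virtual value ± pure remainder.**
For an exact design `(n,t,T,D,B_v,C,w)` with `T + 4 ≤ t`, a perfect matching `M`, a block `H`, `|ψ| ≤ G` and `|χ| ≤ G₂` on `[0,t]`, a real `α`, `m ≥ 3`,
`m + 4(D+1) + 4 ≤ n`, and `x`-smoothness numbers `X_k ≥ 0` (`k ∈ {D−1,D,D+1}`, odd base levels `c′ + 2k ≤ T`) of the deleted shell laws on the `π`-stable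
`S′` with `|S′| + 4k + 2 = n` (cut `t−2−2k`, window `[0,t−2]`) and with `|S′| + 4k + 4 = n` (cut `t−4−2k`, window `[0,t−4]`):
`|Σ_c w_c Φ₁(c) + N^{odd}_D[Φ₁](0)| ≤ B_v·C((T−1)/2,D+1)·K₇`,
`K₇ = G₂(tρ^{D+1}X_{D+1} + 2(D+1)ρ^DX_D) + |α|·G·(t(tρ^{D+1}X_{D+1} + 2(D+1)ρ^DX_D) + 2(D+1)(tρ^DX_D + 2Dρ^{D−1}X_{D−1}))`
(on odd levels `≤ T`, `Φ₁ = α(t−c)(t−2−c)θ₂ + (t−c)θ₁` by full-edge pinning; Leibniz for the affine factors; the exact design's remainder estimate).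
[cite: Rothvoss2017, §2 (PDF p. 6)] [cite: Agarwal2000DifferenceEquations, Thm. 1.8.5 (1.8.6), Remark 1.8.1 (1.8.8)]
[cite: Boole2009, Ch. II Art. 10 Ex. 3 eq. (8) (PDF pp. 34–35)] -/
theorem abs_levelSum_hhMoments_add_newton_le {t T D : ℕ} {Bv : ℝ} {C : Finset ℕ} {w : ℕ → ℝ}
    (hdes : IsExactDesign n t T D Bv C w) (hT4 : T + 4 ≤ t) (M : PMatch n)
    (H : Finset (Fin n)) (ψ χ : ℤ → ℝ) {G G₂ : ℝ} (hG0 : 0 ≤ G) (hG : ∀ x ∈ Icc (0 : ℤ) (t : ℤ), |ψ x| ≤ G)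
    (hG₂0 : 0 ≤ G₂) (hG₂ : ∀ x ∈ Icc (0 : ℤ) (t : ℤ), |χ x| ≤ G₂) (α : ℝ)
    {m : ℕ} (hm : 3 ≤ m) (hmn : m + 4 * (D + 1) + 4 ≤ n) (X : ℕ → ℝ) (hX0 : ∀ k, 0 ≤ X k)
    (hX1 : ∀ k, D ≤ k + 1 → k ≤ D + 1 → ∀ c' : ℕ, Odd c' → c' + 2 * k ≤ T →
      ∀ S' : Finset (Fin n), (∀ u ∈ S', M.2.partner u ∈ S') → S'.card + 4 * k + 2 = n →
      ∑ x ∈ Icc (0 : ℤ) ((t - 2 : ℕ) : ℤ),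
        |nab2^[k] (fun c x => shellLaw M.2.partner S' H (t - 2 - 2 * k) c x : Profile) c' x| ≤ X k)
    (hX2 : ∀ k, D ≤ k + 1 → k ≤ D + 1 → ∀ c' : ℕ, Odd c' → c' + 2 * k ≤ T →
      ∀ S' : Finset (Fin n), (∀ u ∈ S', M.2.partner u ∈ S') → S'.card + 4 * k + 4 = n →
      ∑ x ∈ Icc (0 : ℤ) ((t - 4 : ℕ) : ℤ),
        |nab2^[k] (fun c x => shellLaw M.2.partner S' H (t - 4 - 2 * k) c x : Profile) c' x| ≤ X k) :
    |∑ c ∈ C, w c * ((∑ U' ∈ shell M.2.partner t c,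
          (α * (ψ ((U' ∩ H).card : ℤ) *
            (((((reps M.2.partner (vAA M.2.partner univ H)).filter fun v => v ∈ U' ∧ M.2.partner v ∈ U').card : ℕ) : ℝ) *
              (((((reps M.2.partner (vAA M.2.partner univ H)).filter fun v => v ∈ U' ∧ M.2.partner v ∈ U').card : ℕ) : ℝ) - 1))) +
           χ ((U' ∩ H).card : ℤ) *
            ((((reps M.2.partner (vAA M.2.partner univ H)).filter fun v => v ∈ U' ∧ M.2.partner v ∈ U').card : ℕ) : ℝ))) /
          ((shell M.2.partner t c).card : ℝ)) +
      (DesignRemainder.newtonPolyOdd D (fun c => (∑ U' ∈ shell M.2.partner t c,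
          (α * (ψ ((U' ∩ H).card : ℤ) *
            (((((reps M.2.partner (vAA M.2.partner univ H)).filter fun v => v ∈ U' ∧ M.2.partner v ∈ U').card : ℕ) : ℝ) *
              (((((reps M.2.partner (vAA M.2.partner univ H)).filter fun v => v ∈ U' ∧ M.2.partner v ∈ U').card : ℕ) : ℝ) - 1))) +
           χ ((U' ∩ H).card : ℤ) *
            ((((reps M.2.partner (vAA M.2.partner univ H)).filter fun v => v ∈ U' ∧ M.2.partner v ∈ U').card : ℕ) : ℝ))) /
          ((shell M.2.partner t c).card : ℝ))).eval 0| ≤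
      Bv * ((((T - 1) / 2).choose (D + 1) : ℕ) : ℝ) *
        (G₂ * ((t : ℝ) * (((m : ℝ) / (4 * ((m : ℝ) - 2))) ^ (D + 1) * X (D + 1)) +
            2 * ((D : ℝ) + 1) * (((m : ℝ) / (4 * ((m : ℝ) - 2))) ^ D * X D)) +
          |α| * (G * ((t : ℝ) * ((t : ℝ) * (((m : ℝ) / (4 * ((m : ℝ) - 2))) ^ (D + 1) * X (D + 1)) +
              2 * ((D : ℝ) + 1) * (((m : ℝ) / (4 * ((m : ℝ) - 2))) ^ D * X D)) +
            2 * ((D : ℝ) + 1) * ((t : ℝ) * (((m : ℝ) / (4 * ((m : ℝ) - 2))) ^ D * X D) +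
              2 * (D : ℝ) * (((m : ℝ) / (4 * ((m : ℝ) - 2))) ^ (D - 1) * X (D - 1)))))) := by
  obtain ⟨t₀, rfl⟩ : ∃ t₀, t = t₀ + 4 := ⟨t - 4, by omega⟩
  simp only [Nat.add_sub_cancel, show t₀ + 4 - 2 = t₀ + 2 by omega] at hX1 hX2
  set π := M.2.partner with hπdef
  have hπ : ∀ v, π (π v) = v := partner_partner M
  have hπ' : ∀ v, π v ≠ v := partner_ne M
  have hU : ∀ u ∈ (univ : Finset (Fin n)), π u ∈ (univ : Finset (Fin n)) := fun u _ => mem_univ _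
  set ρ : ℝ := (m : ℝ) / (4 * ((m : ℝ) - 2)) with hρdef
  have hρ0 : 0 ≤ ρ := rho_nonneg hm
  have ht : Odd (t₀ + 4) := hdes.1
  have ht₂ : Odd (t₀ + 2) := by obtain ⟨i, hi⟩ := ht; exact ⟨i - 1, by omega⟩
  have ht₀ : Odd t₀ := by obtain ⟨i, hi⟩ := ht; exact ⟨i - 2, by omega⟩
  have h2t : 2 * (t₀ + 4) + 2 ≤ n := hdes.2.1
  have hTt : T ≤ t₀ + 4 := hdes.2.2.1
  have hn4 : (4 : ℝ) ≤ n := by exact_mod_cast (show 4 ≤ n by omega)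
  have hn0 : (0 : ℝ) < n := by linarith
  set κ₀ : ℝ := 1 / ((n : ℝ) * ((n : ℝ) - 2)) with hκ₀def
  have hκ₀0 : 0 ≤ κ₀ := by rw [hκ₀def]; exact div_nonneg zero_le_one (mul_nonneg (by linarith) (by linarith))
  set R := reps π (vAA π univ H) with hRdef
  have hR2 : 2 * (R.card : ℝ) ≤ n := by
    have h1 := two_mul_card_reps hπ hπ' (vAA_stable hπ univ H hU)
    have h2 : (vAA π univ H).card ≤ n := by
      have := card_le_univ (vAA π univ H); rwa [Fintype.card_fin] at this
    have : 2 * R.card ≤ n := by rw [hRdef]; omega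
    exact_mod_cast this
  -- nA as a function
  set nA : Finset (Fin n) → ℝ := fun U => ((((reps π (vAA π univ H)).filter fun v => v ∈ U ∧ π v ∈ U).card : ℕ) : ℝ)
    with hnA
  -- the deleted shifted profiles and their odd subsequences
  set φ' : Fin n → ℕ → ℝ := fun v c => (∑ W ∈ shellIn π (univ \ {v, π v}) (t₀ + 2) c, χ (((W ∩ H).card : ℤ) + 2)) /
    ((shellIn π (univ \ {v, π v}) (t₀ + 2) c).card : ℝ) with hφ'
  set φ'' : Fin n → Fin n → ℕ → ℝ := fun v w c =>
    (∑ W ∈ shellIn π (del2 π univ v w) t₀ c, ψ (((W ∩ H).card : ℤ) + 4)) /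
      ((shellIn π (del2 π univ v w) t₀ c).card : ℝ) with hφ''
  set g₁ : ℕ → ℝ := fun y => (1 / (n : ℝ)) * ∑ v ∈ R, φ' v (2 * y + 1) with hg₁
  set g₂ : ℕ → ℝ := fun y => κ₀ * ∑ v ∈ R, ∑ w ∈ R.erase v, φ'' v w (2 * y + 1) with hg₂
  set Φ₁ : ℕ → ℝ := fun c => (∑ U' ∈ shell π (t₀ + 4) c, (α * (ψ ((U' ∩ H).card : ℤ) * (nA U' * (nA U' - 1))) +
      χ ((U' ∩ H).card : ℤ) * nA U')) / ((shell π (t₀ + 4) c).card : ℝ) with hΦ₁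
  set Ψ : ℕ → ℝ := fun y => α * ((((t₀ : ℝ) + 3) - 2 * (y : ℝ)) * ((((t₀ : ℝ) + 1) - 2 * (y : ℝ)) * g₂ y)) +
      (((t₀ : ℝ) + 3) - 2 * (y : ℝ)) * g₁ y with hΨ
  -- Step 1: on odd levels `≤ T`, `Φ₁ = Ψ` (full-edge pinning)
  have hlev : ∀ y : ℕ, 2 * y + 1 ≤ T → Φ₁ (2 * y + 1) = Ψ y := by
    intro y hy
    have hsplit : ∑ U' ∈ shell π (t₀ + 4) (2 * y + 1), (α * (ψ ((U' ∩ H).card : ℤ) * (nA U' * (nA U' - 1))) +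
        χ ((U' ∩ H).card : ℤ) * nA U') =
        α * ∑ U' ∈ shell π (t₀ + 4) (2 * y + 1), ψ ((U' ∩ H).card : ℤ) * (nA U' * (nA U' - 1)) +
          ∑ U' ∈ shell π (t₀ + 4) (2 * y + 1), χ ((U' ∩ H).card : ℤ) * nA U' := by
      rw [sum_add_distrib, mul_sum]
    have h1 := shellAvg_hhPairs_eq M H ψ ht ⟨y, rfl⟩ (by omega) (by omega)
    have h2 := shellAvg_hhCount_eq M H χ (t₀ := t₀ + 2) (c := 2 * y + 1) (by rw [show t₀ + 2 + 2 = t₀ + 4 by ring]; exact ht)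
      ⟨y, rfl⟩ (by omega) (by omega)
    rw [show t₀ + 2 + 2 = t₀ + 4 by ring] at h2
    rw [hΦ₁]
    simp only
    rw [hsplit, add_div, mul_div_assoc, hnA, h1, h2, hΨ, hg₁, hg₂, hκ₀def, hφ', hφ'', hRdef]
    simp only
    push_cast
    ring
  -- Step 2: smoothness of `g₁`, `g₂`
  have hG' : ∀ x ∈ Icc (0 : ℤ) ((t₀ + 2 : ℕ) : ℤ), |χ (x + 2)| ≤ G₂ := by
    intro x hx
    refine hG₂ (x + 2) ?_
    rw [mem_Icc] at hx ⊢
    constructor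
    · linarith [hx.1]
    · have := hx.2; push_cast at this ⊢; linarith
  have hG'' : ∀ x ∈ Icc (0 : ℤ) ((t₀ : ℕ) : ℤ), |ψ (x + 4)| ≤ G := by
    intro x hx
    refine hG (x + 4) ?_
    rw [mem_Icc] at hx ⊢
    constructor
    · linarith [hx.1]
    · have := hx.2; push_cast at this ⊢; linarith
  have hK1 : ∀ k, D ≤ k + 1 → k ≤ D + 1 → ∀ y : ℕ, 2 * (y + k) + 1 ≤ T →
      |((fwdDiff (1 : ℕ))^[k] g₁) y| ≤ G₂ * (ρ ^ k * X k) := by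
    intro k hDk hkD y hy
    have hfun : g₁ = fun y => (1 / (n : ℝ)) * ∑ v ∈ R, (fun v y => φ' v (2 * y + 1)) v y := by
      funext y; rw [hg₁]
    rw [hfun, fwdDiff_iter_mul_sum, abs_mul, abs_of_nonneg (by positivity : (0 : ℝ) ≤ 1 / (n : ℝ))]
    have hsplit : t₀ + 2 = (t₀ + 2 - 2 * k) + 2 * k := by omega
    have hbd : ∀ v ∈ R, |(fwdDiff (1 : ℕ))^[k] (fun y => φ' v (2 * y + 1)) y| ≤ G₂ * (ρ ^ k * X k) := by
      intro v _
      rw [fwdDiff_iter_one_odd, hφ']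
      simp only
      rw [hsplit]
      refine abs_fwdDiff_iter_pin1Profile_le M v H (fun x => χ (x + 2)) hG₂0 (by rw [← hsplit]; exact hG')
        (by rw [← hsplit]; exact ht₂) ⟨y, by ring⟩ (by omega) (by omega) hm (by omega) (hX0 k) ?_
      intro S' hS' hcard
      have := hX1 k hDk hkD (2 * y + 1) ⟨y, by ring⟩ (by omega) S' hS' hcard
      rw [← hsplit]
      convert this using 4
    have hsum : |∑ v ∈ R, (fwdDiff (1 : ℕ))^[k] (fun y => φ' v (2 * y + 1)) y| ≤ (R.card : ℝ) * (G₂ * (ρ ^ k * X k)) :=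
      calc |∑ v ∈ R, (fwdDiff (1 : ℕ))^[k] (fun y => φ' v (2 * y + 1)) y|
          ≤ ∑ v ∈ R, |(fwdDiff (1 : ℕ))^[k] (fun y => φ' v (2 * y + 1)) y| := abs_sum_le_sum_abs _ _
        _ ≤ ∑ v ∈ R, G₂ * (ρ ^ k * X k) := sum_le_sum hbd
        _ = (R.card : ℝ) * (G₂ * (ρ ^ k * X k)) := by rw [sum_const, nsmul_eq_mul]
    have hGX : 0 ≤ G₂ * (ρ ^ k * X k) := mul_nonneg hG₂0 (mul_nonneg (pow_nonneg hρ0 k) (hX0 k))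
    have hRn : (R.card : ℝ) ≤ n := by linarith [Nat.cast_nonneg (α := ℝ) R.card]
    calc 1 / (n : ℝ) * |∑ v ∈ R, (fwdDiff (1 : ℕ))^[k] (fun y => φ' v (2 * y + 1)) y|
        ≤ 1 / (n : ℝ) * ((n : ℝ) * (G₂ * (ρ ^ k * X k))) :=
          mul_le_mul_of_nonneg_left (hsum.trans (mul_le_mul_of_nonneg_right hRn hGX)) (by positivity)
      _ = G₂ * (ρ ^ k * X k) := by field_simp
  have hK2 : ∀ k, D ≤ k + 1 → k ≤ D + 1 → ∀ y : ℕ, 2 * (y + k) + 1 ≤ T →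
      |((fwdDiff (1 : ℕ))^[k] g₂) y| ≤ G * (ρ ^ k * X k) := by
    intro k hDk hkD y hy
    have hGX : 0 ≤ G * (ρ ^ k * X k) := mul_nonneg hG0 (mul_nonneg (pow_nonneg hρ0 k) (hX0 k))
    have hfun : g₂ = fun y => κ₀ * ∑ v ∈ R, (fun v y => ∑ w ∈ R.erase v, φ'' v w (2 * y + 1)) v y := by
      funext y; rw [hg₂]
    rw [hfun, fwdDiff_iter_mul_sum, abs_mul, abs_of_nonneg hκ₀0]
    have hsplit : t₀ = (t₀ - 2 * k) + 2 * k := by omega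
    have hinner : ∀ v ∈ R, |(fwdDiff (1 : ℕ))^[k] (fun y => ∑ w ∈ R.erase v, φ'' v w (2 * y + 1)) y| ≤
        (R.card : ℝ) * (G * (ρ ^ k * X k)) := by
      intro v hv
      have hfun2 : (fun y => ∑ w ∈ R.erase v, φ'' v w (2 * y + 1)) =
          fun y => (1 : ℝ) * ∑ w ∈ R.erase v, (fun w y => φ'' v w (2 * y + 1)) w y := by
        funext y; rw [one_mul]
      rw [hfun2, fwdDiff_iter_mul_sum, one_mul]
      have hbd : ∀ w' ∈ R.erase v, |(fwdDiff (1 : ℕ))^[k] (fun y => φ'' v w' (2 * y + 1)) y| ≤ G * (ρ ^ k * X k) := by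
        intro w' hw'
        obtain ⟨hwv, hw'R⟩ := mem_erase.1 hw'
        have hwπ : w' ≠ π v := fun h => by
          have h1 := (mem_reps.1 hv).2
          have h2 := (mem_reps.1 hw'R).2
          rw [h, hπ] at h2
          exact lt_asymm h1 h2
        rw [fwdDiff_iter_one_odd, hφ'']
        simp only
        rw [hsplit]
        refine abs_fwdDiff_iter_pin2Profile_le M hwv hwπ H (fun x => ψ (x + 4)) hG0 (by rw [← hsplit]; exact hG'')
          (by rw [← hsplit]; exact ht₀) ⟨y, by ring⟩ (by omega) (by omega) hm (by omega) (hX0 k) ?_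
        intro S' hS' hcard
        have := hX2 k hDk hkD (2 * y + 1) ⟨y, by ring⟩ (by omega) S' hS' hcard
        rw [← hsplit]
        convert this using 4
      calc |∑ w' ∈ R.erase v, (fwdDiff (1 : ℕ))^[k] (fun y => φ'' v w' (2 * y + 1)) y|
          ≤ ∑ w' ∈ R.erase v, |(fwdDiff (1 : ℕ))^[k] (fun y => φ'' v w' (2 * y + 1)) y| := abs_sum_le_sum_abs _ _
        _ ≤ ∑ w' ∈ R.erase v, G * (ρ ^ k * X k) := sum_le_sum hbd
        _ = ((R.erase v).card : ℝ) * (G * (ρ ^ k * X k)) := by rw [sum_const, nsmul_eq_mul]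
        _ ≤ (R.card : ℝ) * (G * (ρ ^ k * X k)) := by
            refine mul_le_mul_of_nonneg_right ?_ hGX
            exact_mod_cast card_le_card (erase_subset _ _)
    have hsum : |∑ v ∈ R, (fwdDiff (1 : ℕ))^[k] (fun y => ∑ w ∈ R.erase v, φ'' v w (2 * y + 1)) y| ≤
        (R.card : ℝ) * ((R.card : ℝ) * (G * (ρ ^ k * X k))) :=
      calc |∑ v ∈ R, (fwdDiff (1 : ℕ))^[k] (fun y => ∑ w ∈ R.erase v, φ'' v w (2 * y + 1)) y|
          ≤ ∑ v ∈ R, |(fwdDiff (1 : ℕ))^[k] (fun y => ∑ w ∈ R.erase v, φ'' v w (2 * y + 1)) y| := abs_sum_le_sum_abs _ _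
        _ ≤ ∑ v ∈ R, (R.card : ℝ) * (G * (ρ ^ k * X k)) := sum_le_sum hinner
        _ = (R.card : ℝ) * ((R.card : ℝ) * (G * (ρ ^ k * X k))) := by rw [sum_const, nsmul_eq_mul]
    -- `κ₀ · |R|² ≤ 1` from `2|R| ≤ n`
    have hR0 : (0 : ℝ) ≤ R.card := Nat.cast_nonneg _
    have hRR : (R.card : ℝ) * (R.card : ℝ) ≤ (n : ℝ) * ((n : ℝ) - 2) := by nlinarith
    calc κ₀ * |∑ v ∈ R, (fwdDiff (1 : ℕ))^[k] (fun y => ∑ w ∈ R.erase v, φ'' v w (2 * y + 1)) y|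
        ≤ κ₀ * ((R.card : ℝ) * ((R.card : ℝ) * (G * (ρ ^ k * X k)))) := mul_le_mul_of_nonneg_left hsum hκ₀0
      _ = (κ₀ * ((R.card : ℝ) * (R.card : ℝ))) * (G * (ρ ^ k * X k)) := by ring
      _ ≤ (κ₀ * ((n : ℝ) * ((n : ℝ) - 2))) * (G * (ρ ^ k * X k)) :=
          mul_le_mul_of_nonneg_right (mul_le_mul_of_nonneg_left hRR hκ₀0) hGX
      _ = G * (ρ ^ k * X k) := by
          rw [hκ₀def]
          have h1 : (n : ℝ) ≠ 0 := by positivity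
          have h2 : (n : ℝ) - 2 ≠ 0 := (show (0 : ℝ) < (n : ℝ) - 2 by linarith).ne'
          field_simp
  -- Step 3: the `(D+1)`-st difference of `Ψ`
  have hΨsplit : Ψ = α • (fun y : ℕ => (((t₀ : ℝ) + 3) - 2 * (y : ℝ)) * ((fun y : ℕ => (((t₀ : ℝ) + 1) - 2 * (y : ℝ)) * g₂ y) y)) +
      (fun y : ℕ => (((t₀ : ℝ) + 3) - 2 * (y : ℝ)) * g₁ y) := by
    funext y; simp only [hΨ, Pi.add_apply, Pi.smul_apply, smul_eq_mul]
  set K₇ : ℝ := G₂ * (((t₀ : ℝ) + 4) * (ρ ^ (D + 1) * X (D + 1)) + 2 * ((D : ℝ) + 1) * (ρ ^ D * X D)) +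
      |α| * (G * (((t₀ : ℝ) + 4) * (((t₀ : ℝ) + 4) * (ρ ^ (D + 1) * X (D + 1)) + 2 * ((D : ℝ) + 1) * (ρ ^ D * X D)) +
        2 * ((D : ℝ) + 1) * (((t₀ : ℝ) + 4) * (ρ ^ D * X D) + 2 * (D : ℝ) * (ρ ^ (D - 1) * X (D - 1))))) with hK₇
  have hK₇0 : 0 ≤ K₇ := by
    have := hX0 (D + 1); have := hX0 D; have := hX0 (D - 1)
    rw [hK₇]; positivity
  have hK : ∀ j : ℕ, 2 * (j + D + 1) + 1 ≤ T →
      |((fwdDiff (1 : ℕ))^[D + 1] (fun j => Φ₁ (2 * j + 1))) j| ≤ K₇ := by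
    intro j hj
    rw [fwdDiff_iter_one_congr_of_le (D + 1) (g := Ψ) (fun i hi => hlev (j + i) (by omega)), hΨsplit, fwdDiff_iter_add,
      fwdDiff_iter_const_smul, Pi.add_apply, Pi.smul_apply, smul_eq_mul]
    -- affine factor bounds
    have hyT : 2 * (j : ℝ) + 2 ≤ (t₀ : ℝ) + 1 := by exact_mod_cast (show 2 * j + 2 ≤ t₀ + 1 by omega)
    have hj0 : (0 : ℝ) ≤ j := Nat.cast_nonneg _
    have hA3 : |((t₀ : ℝ) + 3) - 2 * (j : ℝ)| ≤ (t₀ : ℝ) + 4 := by rw [abs_le]; constructor <;> linarith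
    have hA1 : |((t₀ : ℝ) + 1) - 2 * (j : ℝ)| ≤ (t₀ : ℝ) + 4 := by rw [abs_le]; constructor <;> linarith
    have hA1' : |((t₀ : ℝ) + 1) - 2 * ((j + 1 : ℕ) : ℝ)| ≤ (t₀ : ℝ) + 4 := by
      push_cast; rw [abs_le]; constructor <;> linarith
    -- the `g₁` part
    have hP1 : |(fwdDiff (1 : ℕ))^[D + 1] (fun y : ℕ => (((t₀ : ℝ) + 3) - 2 * (y : ℝ)) * g₁ y) j| ≤
        G₂ * (((t₀ : ℝ) + 4) * (ρ ^ (D + 1) * X (D + 1)) + 2 * ((D : ℝ) + 1) * (ρ ^ D * X D)) := by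
      refine (abs_fwdDiff_iter_affMul_le g₁ (D + 1) j hA3).trans ?_
      have h1 := hK1 (D + 1) (by omega) le_rfl j (by omega)
      have h2 := hK1 D (by omega) (by omega) (j + 1) (by omega)
      simp only [Nat.add_sub_cancel]
      push_cast
      calc ((t₀ : ℝ) + 4) * |(fwdDiff (1 : ℕ))^[D + 1] g₁ j| + 2 * ((D : ℝ) + 1) * |(fwdDiff (1 : ℕ))^[D] g₁ (j + 1)|
          ≤ ((t₀ : ℝ) + 4) * (G₂ * (ρ ^ (D + 1) * X (D + 1))) + 2 * ((D : ℝ) + 1) * (G₂ * (ρ ^ D * X D)) := by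
            gcongr
        _ = _ := by ring
    -- the `g₂` part (nested affine Leibniz)
    have hP2 : |(fwdDiff (1 : ℕ))^[D + 1]
          (fun y : ℕ => (((t₀ : ℝ) + 3) - 2 * (y : ℝ)) * ((fun y : ℕ => (((t₀ : ℝ) + 1) - 2 * (y : ℝ)) * g₂ y) y)) j| ≤
        G * (((t₀ : ℝ) + 4) * (((t₀ : ℝ) + 4) * (ρ ^ (D + 1) * X (D + 1)) + 2 * ((D : ℝ) + 1) * (ρ ^ D * X D)) +
          2 * ((D : ℝ) + 1) * (((t₀ : ℝ) + 4) * (ρ ^ D * X D) + 2 * (D : ℝ) * (ρ ^ (D - 1) * X (D - 1)))) := by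
      refine (abs_fwdDiff_iter_affMul_le (fun y : ℕ => (((t₀ : ℝ) + 1) - 2 * (y : ℝ)) * g₂ y) (D + 1) j hA3).trans ?_
      simp only [Nat.add_sub_cancel]
      have hQ1 : |(fwdDiff (1 : ℕ))^[D + 1] (fun y : ℕ => (((t₀ : ℝ) + 1) - 2 * (y : ℝ)) * g₂ y) j| ≤
          ((t₀ : ℝ) + 4) * (G * (ρ ^ (D + 1) * X (D + 1))) + 2 * ((D : ℝ) + 1) * (G * (ρ ^ D * X D)) := by
        refine (abs_fwdDiff_iter_affMul_le g₂ (D + 1) j hA1).trans ?_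
        have h1 := hK2 (D + 1) (by omega) le_rfl j (by omega)
        have h2 := hK2 D (by omega) (by omega) (j + 1) (by omega)
        simp only [Nat.add_sub_cancel]
        push_cast
        gcongr
      have hQ2 : |(fwdDiff (1 : ℕ))^[D] (fun y : ℕ => (((t₀ : ℝ) + 1) - 2 * (y : ℝ)) * g₂ y) (j + 1)| ≤
          ((t₀ : ℝ) + 4) * (G * (ρ ^ D * X D)) + 2 * (D : ℝ) * (G * (ρ ^ (D - 1) * X (D - 1))) := by
        refine (abs_fwdDiff_iter_affMul_le g₂ D (j + 1) hA1').trans ?_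
        have h1 := hK2 D (by omega) (by omega) (j + 1) (by omega)
        have h2 : 2 * (D : ℝ) * |(fwdDiff (1 : ℕ))^[D - 1] g₂ (j + 1 + 1)| ≤ 2 * (D : ℝ) * (G * (ρ ^ (D - 1) * X (D - 1))) := by
          rcases Nat.eq_zero_or_pos D with hD0 | hDpos
          · subst hD0; simp
          · exact mul_le_mul_of_nonneg_left (hK2 (D - 1) (by omega) (by omega) (j + 1 + 1) (by omega)) (by positivity)
        exact add_le_add (mul_le_mul_of_nonneg_left h1 (by positivity)) h2
      push_cast
      calc ((t₀ : ℝ) + 4) * |(fwdDiff (1 : ℕ))^[D + 1] (fun y : ℕ => (((t₀ : ℝ) + 1) - 2 * (y : ℝ)) * g₂ y) j| +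
            2 * ((D : ℝ) + 1) * |(fwdDiff (1 : ℕ))^[D] (fun y : ℕ => (((t₀ : ℝ) + 1) - 2 * (y : ℝ)) * g₂ y) (j + 1)|
          ≤ ((t₀ : ℝ) + 4) * (((t₀ : ℝ) + 4) * (G * (ρ ^ (D + 1) * X (D + 1))) + 2 * ((D : ℝ) + 1) * (G * (ρ ^ D * X D))) +
            2 * ((D : ℝ) + 1) * (((t₀ : ℝ) + 4) * (G * (ρ ^ D * X D)) + 2 * (D : ℝ) * (G * (ρ ^ (D - 1) * X (D - 1)))) := by
            gcongr
        _ = _ := by ring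
    calc |α * (fwdDiff (1 : ℕ))^[D + 1]
            (fun y : ℕ => (((t₀ : ℝ) + 3) - 2 * (y : ℝ)) * ((fun y : ℕ => (((t₀ : ℝ) + 1) - 2 * (y : ℝ)) * g₂ y) y)) j +
          (fwdDiff (1 : ℕ))^[D + 1] (fun y : ℕ => (((t₀ : ℝ) + 3) - 2 * (y : ℝ)) * g₁ y) j|
        ≤ |α * (fwdDiff (1 : ℕ))^[D + 1]
            (fun y : ℕ => (((t₀ : ℝ) + 3) - 2 * (y : ℝ)) * ((fun y : ℕ => (((t₀ : ℝ) + 1) - 2 * (y : ℝ)) * g₂ y) y)) j| +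
          |(fwdDiff (1 : ℕ))^[D + 1] (fun y : ℕ => (((t₀ : ℝ) + 3) - 2 * (y : ℝ)) * g₁ y) j| := abs_add_le _ _
      _ ≤ |α| * (G * (((t₀ : ℝ) + 4) * (((t₀ : ℝ) + 4) * (ρ ^ (D + 1) * X (D + 1)) + 2 * ((D : ℝ) + 1) * (ρ ^ D * X D)) +
          2 * ((D : ℝ) + 1) * (((t₀ : ℝ) + 4) * (ρ ^ D * X D) + 2 * (D : ℝ) * (ρ ^ (D - 1) * X (D - 1))))) +
          G₂ * (((t₀ : ℝ) + 4) * (ρ ^ (D + 1) * X (D + 1)) + 2 * ((D : ℝ) + 1) * (ρ ^ D * X D)) := by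
          rw [abs_mul]
          exact add_le_add (mul_le_mul_of_nonneg_left hP2 (abs_nonneg _)) hP1
      _ = K₇ := by rw [hK₇]; ring
  -- Step 4: the exact design's remainder estimate
  have hrem := hdes.abs_levelSum_add_le_of_fwdDiff_odd Φ₁ hK₇0 hK
  refine hrem.trans (le_of_eq ?_)
  rw [hK₇]
  push_cast
  ring

end Summit.PneNP.PneNP.Theorems.ChebyshevTracialDesignGammaDirectionMainTerm

end
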